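import Mathlib
import Literature.NumberTheory.DiophantineGeometry.SaturatedBoxCount
import HarnessLib

/-!
# The count of the saturated exponent family in a skew box (`card_satBox_ge`)

Support file (theorems only; no named facts). Cell `abc-stewartyu`, route `YuMatveevShapeRat`, crux
`PadicCoreOddRat` (stmt-ABC-20503), WP-L.P(odd): the COUNT consumed by p2's START over the saturated lattice
(`PadicG3SatStart.satFam`; plan g11 ASSIGN (1) 2026-08-27T15:32:46Z), seat p1 (lattice kit). It is the tree's
N1 `Dioph.exists_finset_lattice_box` (p515757) transported to θ-coordinates.

Setting (p2's `SatData` / p3's `SatFrameKit`): integer matrices `U, C` with `C·U = N·1` (only this product is used), `N ≥ 1`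
(`αⱼ = ∏ᵢ θᵢ^{C j i}`, `θᵢ^N = ∏ⱼ αⱼ^{U i j}`); an exponent vector `μ ∈ ℤⁿ` in θ-coordinates has the VIRTUAL
α-coordinates `ν(μ) = μ ᵥ* U = N·λ`, `λ = μ·C⁻¹ ∈ 𝔑 := ℤⁿ·C⁻¹ ⊇ ℤⁿ`, `[𝔑 : ℤⁿ] = |det C|`. The family of the
frame is `{μ ∈ ℤⁿ : |μₖ| ≤ Lcₖ, |ν(μ)ⱼ| ≤ N·sⱼ}`; this file proves

* `relIndex_closure_latN` — `[𝔑 : ℤⁿ] = |det C|` for `𝔑 = {λ ∈ ℚⁿ : λ ᵥ* C ∈ ℤⁿ}` (Mathlib's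
  `AddSubgroup.index_eq_natAbs_det` transported along `λ ↦ λ ᵥ* C`);
* **`card_satBox_ge`** — if `Σⱼ sⱼ·|C j k| ≤ Lcₖ` for every `k`, then
  `|det C| · ∏ⱼ (2·sⱼ) ≤ #{μ ∈ box Lc | ∀ j, |(μ ᵥ* U) j| ≤ N·sⱼ}` — the image `λ ↦ λ ᵥ* C` of N1's
  `|det C|·∏(2sⱼ)` points of `𝔑 ∩ {|λⱼ| ≤ sⱼ}`.

## References
* [Nesterenko2003] Yu. V. Nesterenko, LNM 1819 (2003) — §3.3 Prop 3.4(2), §3.4 (the lattice `𝔑`, `N = [𝔑:ℤⁿ]`),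
  §3.5 (the set `𝔏`).
-/

noncomputable section

open Finset Matrix

namespace Summit.ABC.StewartYu

namespace SatBox

variable {n : ℕ}

/-- The coordinatewise cast `ℤⁿ → ℚⁿ` as an additive homomorphism. [folklore] -/
def ιZQ (n : ℕ) : (Fin n → ℤ) →+ (Fin n → ℚ) := (Int.castAddHom ℚ).compLeft (Fin n)

/-- `ιZQ n z j = (z j : ℚ)`. [folklore] -/
@[simp] theorem ιZQ_apply (z : Fin n → ℤ) (j : Fin n) : ιZQ n z j = (z j : ℚ) := rfl

/-- `ιZQ` is injective. [folklore] -/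
theorem ιZQ_injective : Function.Injective (ιZQ n) := by
  intro z z' h
  funext j
  have := congrFun h j
  simpa using this

/-- **`ℤⁿ ≤ ℚⁿ` (the closure of the standard basis) is the range of the cast.** [folklore] -/
theorem closure_basisFun_eq_range :
    AddSubgroup.closure (Set.range ⇑(Pi.basisFun ℚ (Fin n))) = (ιZQ n).range := by
  apply le_antisymm
  · rw [AddSubgroup.closure_le]
    rintro _ ⟨i, rfl⟩
    refine ⟨Pi.single i 1, ?_⟩
    funext j
    simp [Pi.basisFun_apply, Pi.single_apply]
  · rintro _ ⟨z, rfl⟩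
    have h := Literature.NumberTheory.DiophantineGeometry.Dioph.intCast_mem_closure_basisFun z
    exact h

/-- `vecMul` commutes with the cast: `(ι z) ᵥ* C_ℚ = ι (z ᵥ* C)`. [folklore] -/
theorem ιZQ_vecMul (C : Matrix (Fin n) (Fin n) ℤ) (z : Fin n → ℤ) :
    (ιZQ n z) ᵥ* C.map (Int.cast : ℤ → ℚ) = ιZQ n (z ᵥ* C) := by
  funext j
  simp [Matrix.vecMul, dotProduct, Matrix.map_apply]

/-- The lattice `𝔑_C = {λ ∈ ℚⁿ : λ ᵥ* C ∈ ℤⁿ}` (as the comap of `ℤⁿ` under `λ ↦ λ ᵥ* C`). [cite: Nesterenko2003, §3.4] -/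
def latN (C : Matrix (Fin n) (Fin n) ℤ) : AddSubgroup (Fin n → ℚ) :=
  (AddSubgroup.closure (Set.range ⇑(Pi.basisFun ℚ (Fin n)))).comap
    (Matrix.mulVecLin (C.map (Int.cast : ℤ → ℚ)).transpose).toAddMonoidHom

/-- membership in `𝔑_C`: `λ ∈ 𝔑_C ↔ ∃ z : ℤⁿ, λ ᵥ* C = z`. [folklore] -/
theorem mem_latN {C : Matrix (Fin n) (Fin n) ℤ} {x : Fin n → ℚ} :
    x ∈ latN C ↔ ∃ z : Fin n → ℤ, x ᵥ* C.map (Int.cast : ℤ → ℚ) = ιZQ n z := by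
  unfold latN
  rw [AddSubgroup.mem_comap, closure_basisFun_eq_range]
  simp only [LinearMap.toAddMonoidHom_coe, Matrix.mulVecLin_apply, Matrix.mulVec_transpose]
  constructor
  · rintro ⟨z, hz⟩; exact ⟨z, hz.symm⟩
  · rintro ⟨z, hz⟩; exact ⟨z, hz.symm⟩

/-- `ℤⁿ ≤ 𝔑_C`. [cite: Nesterenko2003, §3.4] -/
theorem closure_le_latN (C : Matrix (Fin n) (Fin n) ℤ) :
    AddSubgroup.closure (Set.range ⇑(Pi.basisFun ℚ (Fin n))) ≤ latN C := by
  rw [closure_basisFun_eq_range]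
  rintro _ ⟨z, rfl⟩
  exact mem_latN.mpr ⟨z ᵥ* C, ιZQ_vecMul C z⟩

/-- **`[𝔑_C : ℤⁿ] = |det C|`** for `det C ≠ 0`. [cite: Nesterenko2003, §3.4 (p. 105)] -/
theorem relIndex_closure_latN (C : Matrix (Fin n) (Fin n) ℤ) (hC : C.det ≠ 0) :
    (AddSubgroup.closure (Set.range ⇑(Pi.basisFun ℚ (Fin n)))).relIndex (latN C) = C.det.natAbs := by
  classical
  -- the maps
  set Cq : Matrix (Fin n) (Fin n) ℚ := C.map (Int.cast : ℤ → ℚ) with hCq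
  set f : (Fin n → ℚ) →+ (Fin n → ℚ) := (Matrix.mulVecLin Cq.transpose).toAddMonoidHom with hf
  set g : (Fin n → ℤ) →+ (Fin n → ℤ) := (Matrix.mulVecLin C.transpose).toAddMonoidHom with hg
  have hf_apply : ∀ x, f x = x ᵥ* Cq := fun x => by simp [hf]
  have hg_apply : ∀ z, g z = z ᵥ* C := fun z => by simp [hg]
  have hdetq : Cq.det ≠ 0 := by
    have : Cq.det = ((C.det : ℤ) : ℚ) := by rw [hCq, Int.cast_det]
    rw [this]; exact_mod_cast hC
  have hdetqT : Cq.transpose.det ≠ 0 := by rwa [Matrix.det_transpose]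
  -- `f` is injective and surjective
  have hfinj : Function.Injective f := by
    intro x y hxy
    rw [← sub_eq_zero]
    refine Matrix.eq_zero_of_mulVec_eq_zero hdetqT ?_
    rw [Matrix.mulVec_transpose, Matrix.sub_vecMul, sub_eq_zero, ← hf_apply, ← hf_apply, hxy]
  have hfsurj : Function.Surjective f := by
    have hunit : IsUnit Cq.transpose.det := isUnit_iff_ne_zero.mpr hdetqT
    intro y
    refine ⟨(Cq.transpose)⁻¹ *ᵥ y, ?_⟩
    rw [hf_apply, ← Matrix.mulVec_transpose, Matrix.mulVec_mulVec, Matrix.mul_nonsing_inv _ hunit,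
      Matrix.one_mulVec]
  -- `Zn = map ι ⊤`, `map f Zn = map ι (range g)`
  set Zn := AddSubgroup.closure (Set.range ⇑(Pi.basisFun ℚ (Fin n))) with hZn
  have hZn_eq : Zn = AddSubgroup.map (ιZQ n) ⊤ := by
    rw [hZn, closure_basisFun_eq_range, AddMonoidHom.range_eq_map]
  have hfι : ∀ z, f (ιZQ n z) = ιZQ n (g z) := fun z => by
    rw [hf_apply, hg_apply]; exact ιZQ_vecMul C z
  have hmapf : AddSubgroup.map f Zn = AddSubgroup.map (ιZQ n) g.range := by
    rw [hZn_eq, AddSubgroup.map_map, AddMonoidHom.range_eq_map, AddSubgroup.map_map]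
    congr 1
    exact AddMonoidHom.ext fun z => hfι z
  -- `Zn.relIndex (latN C) = (map f Zn).relIndex Zn`
  have hlat : latN C = Zn.comap f := rfl
  have h1 : Zn.relIndex (latN C) = (AddSubgroup.map f Zn).relIndex Zn := by
    have e1 : Zn = (AddSubgroup.map f Zn).comap f :=
      (AddSubgroup.comap_map_eq_self_of_injective hfinj Zn).symm
    conv_lhs => rw [e1, hlat]
    rw [AddSubgroup.relIndex_comap, AddSubgroup.map_comap_eq_self_of_surjective hfsurj]
  -- `(map ι (range g)).relIndex (map ι ⊤) = (range g).index = |det Cᵀ|`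
  have h2 : (AddSubgroup.map f Zn).relIndex Zn = g.range.index := by
    rw [hmapf, hZn_eq, AddSubgroup.relIndex_map_map_of_injective _ _ ιZQ_injective,
      AddSubgroup.relIndex_top_right]
  have h3 : g.range.index = C.det.natAbs := by
    -- Mathlib's `AddSubgroup.index_eq_natAbs_det` for the basis `z ↦ Cᵀ z` of the range
    have hCT : C.transpose.det ≠ 0 := by rwa [Matrix.det_transpose]
    have hinj : Function.Injective g := fun m m' h => by
      rw [← sub_eq_zero]
      refine Matrix.eq_zero_of_mulVec_eq_zero hCT ?_
      rw [Matrix.mulVec_transpose, Matrix.sub_vecMul, sub_eq_zero, ← hg_apply, ← hg_apply, h]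
    let e : (Fin n → ℤ) ≃ₗ[ℤ] g.range := (AddMonoidHom.ofInjective hinj).toIntLinearEquiv
    rw [AddSubgroup.index_eq_natAbs_det (Pi.basisFun ℤ (Fin n)) g.range ((Pi.basisFun ℤ (Fin n)).map e)]
    have hfun : (fun i => ((((Pi.basisFun ℤ (Fin n)).map e) i : g.range) : Fin n → ℤ)) =
        Matrix.mulVecLin C.transpose ∘ Pi.basisFun ℤ (Fin n) := by
      funext i; rfl
    rw [hfun, Module.Basis.det_comp, Module.Basis.det_self, mul_one, ← Matrix.toLin'_apply',
      LinearMap.det_toLin', Matrix.det_transpose]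
  rw [h1, h2, h3]

/-- **THE COUNT OF THE SATURATED FAMILY IN THE SKEW BOX.** For integer matrices `U, C` with
`C·U = N·1`, `N ≥ 1`, box sides `s : Fin n → ℕ` and θ-box bounds `Lc` with `Σⱼ sⱼ·|C j k| ≤ Lc k`:
`|det C| · ∏ⱼ (2·sⱼ) ≤ #{μ ∈ ∏ₖ [−Lcₖ, Lcₖ] | ∀ j, |(μ ᵥ* U) j| ≤ N·sⱼ}`.
[cite: Nesterenko2003, §3.3 Prop 3.4(2), §3.5 (the count of 𝔏)] -/
theorem card_satBox_ge (N : ℕ) (hN : 1 ≤ N) (U C : Matrix (Fin n) (Fin n) ℤ)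
    (hCU : C * U = (N : ℤ) • (1 : Matrix (Fin n) (Fin n) ℤ))
    (s Lc : Fin n → ℕ) (hLc : ∀ k, ∑ j, (s j : ℤ) * |C j k| ≤ Lc k) :
    C.det.natAbs * ∏ j, (2 * s j) ≤
      ((Fintype.piFinset fun k => Finset.Icc (-(Lc k : ℤ)) (Lc k)).filter
        fun μ => ∀ j, |(μ ᵥ* U) j| ≤ (N : ℤ) * s j).card := by
  classical
  -- `det C ≠ 0` (from `det C · det U = Nⁿ`)
  have hdet : C.det ≠ 0 := by
    intro h0
    have h := congrArg Matrix.det hCU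
    rw [Matrix.det_mul, h0, zero_mul, Matrix.det_smul, Matrix.det_one, mul_one, Fintype.card_fin] at h
    have : ((N : ℤ)) ^ n ≠ 0 := pow_ne_zero _ (by exact_mod_cast (show N ≠ 0 by omega))
    exact this h.symm
  -- N1 on the lattice `𝔑_C`
  obtain ⟨𝔏, hcard, hmem, hbox⟩ :=
    Literature.NumberTheory.DiophantineGeometry.Dioph.exists_finset_lattice_box (latN C) (closure_le_latN C)
      (by rw [relIndex_closure_latN C hdet]; exact Int.natAbs_ne_zero.mpr hdet) s
  rw [relIndex_closure_latN C hdet] at hcard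
  -- the transport `λ ↦ λ ᵥ* C` (an integer vector)
  set Cq : Matrix (Fin n) (Fin n) ℚ := C.map (Int.cast : ℤ → ℚ) with hCq
  have hdetq : Cq.transpose.det ≠ 0 := by
    rw [Matrix.det_transpose]
    have : Cq.det = ((C.det : ℤ) : ℚ) := by rw [hCq, Int.cast_det]
    rw [this]; exact_mod_cast hdet
  choose! z hz using fun x (hx : x ∈ 𝔏) => (mem_latN.mp (hmem x hx))
  -- injectivity of `x ↦ z x` on `𝔏` (as `x ᵥ* C_ℚ = z x` and `·ᵥ* C_ℚ` is injective)
  have hinj : Set.InjOn z ↑𝔏 := by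
    intro x hx y hy hxy
    have h : x ᵥ* Cq = y ᵥ* Cq := by rw [hz x hx, hz y hy, hxy]
    rw [← sub_eq_zero]
    refine Matrix.eq_zero_of_mulVec_eq_zero hdetq ?_
    rw [Matrix.mulVec_transpose, Matrix.sub_vecMul, h, sub_self]
  -- the image lies in the filter
  have himg : 𝔏.image z ⊆ (Fintype.piFinset fun k => Finset.Icc (-(Lc k : ℤ)) (Lc k)).filter
      fun μ => ∀ j, |(μ ᵥ* U) j| ≤ (N : ℤ) * s j := by
    intro μ hμ
    obtain ⟨x, hx, rfl⟩ := Finset.mem_image.mp hμ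
    have hxz := hz x hx
    have hxbox := hbox x hx
    -- coordinates of `z x = x ᵥ* C`
    have hcoord : ∀ k, ((z x k : ℤ) : ℚ) = ∑ j, x j * (C j k : ℚ) := by
      intro k
      have := congrFun hxz k
      simp only [ιZQ_apply] at this
      rw [← this]
      simp [Matrix.vecMul, dotProduct, Matrix.map_apply]
    rw [Finset.mem_filter, Fintype.mem_piFinset]
    refine ⟨fun k => ?_, fun j => ?_⟩
    · -- `|z x k| ≤ Σ sⱼ |C j k| ≤ Lc k`
      rw [Finset.mem_Icc, ← abs_le]
      have h1 : |((z x k : ℤ) : ℚ)| ≤ ∑ j, (s j : ℚ) * |(C j k : ℚ)| := by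
        rw [hcoord k]
        refine (Finset.abs_sum_le_sum_abs _ _).trans (Finset.sum_le_sum fun j _ => ?_)
        rw [abs_mul]
        exact mul_le_mul_of_nonneg_right (hxbox j) (abs_nonneg _)
      have h2 : (|z x k| : ℤ) ≤ ∑ j, (s j : ℤ) * |C j k| := by
        have : ((|z x k| : ℤ) : ℚ) ≤ ((∑ j, (s j : ℤ) * |C j k| : ℤ) : ℚ) := by
          push_cast; exact h1
        exact_mod_cast this
      exact h2.trans (hLc k)
    · -- `(z x) ᵥ* U = N • x` as rationals, so `|(z x ᵥ* U) j| = N |x j| ≤ N s j`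
      have hU : ιZQ n ((z x) ᵥ* U) = (N : ℚ) • x := by
        rw [← ιZQ_vecMul U (z x), ← hxz, Matrix.vecMul_vecMul, ← hCq]
        have hmap : (C * U).map (Int.cast : ℤ → ℚ) = Cq * U.map (Int.cast : ℤ → ℚ) := by
          rw [hCq]; ext i k; simp only [Matrix.map_apply, Matrix.mul_apply]; push_cast; rfl
        have : Cq * U.map (Int.cast : ℤ → ℚ) = (N : ℚ) • (1 : Matrix (Fin n) (Fin n) ℚ) := by
          rw [← hmap, hCU]; ext i k
          simp only [Matrix.map_apply, Matrix.smul_apply, Matrix.one_apply, smul_eq_mul]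
          split_ifs <;> simp
        rw [this, Matrix.vecMul_smul, Matrix.vecMul_one]
      have hj := congrFun hU j
      simp only [ιZQ_apply, Pi.smul_apply, smul_eq_mul] at hj
      have : |(((z x ᵥ* U) j : ℤ) : ℚ)| ≤ (N : ℚ) * s j := by
        rw [hj, abs_mul, abs_of_nonneg (by positivity : (0 : ℚ) ≤ N)]
        exact mul_le_mul_of_nonneg_left (hxbox j) (by positivity)
      exact_mod_cast this
  calc C.det.natAbs * ∏ j, (2 * s j) = 𝔏.card := hcard.symm
    _ = (𝔏.image z).card := (Finset.card_image_of_injOn hinj).symm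
    _ ≤ _ := Finset.card_le_card himg

end SatBox

end Summit.ABC.StewartYu
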